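import Summits.CriticalPhenomena.PercolationContinuityZ3.Theorems.PercAnnulusCrossingSlabThm31OfSnapGadgets
import Literature.Probability.Percolation.SlabRSWSnapGadget
import HarnessLib

/-!
# NTW 2017, Theorem 3.1 at `p_c(S_k)`: the box-crossing property for critical percolation on slabs

builds on p205010 (kernel theorem, internal audit signed; external expert review pending) — NOT used in this file.

Cell `prim-rsw3` (LANE 3), p1 GEN 31.  Support file (`--supports stmt-CriticalPhenomena-4575`); no definitions, no
named-fact hypotheses, no sorries.  The discharge of the named fact
`Literature.Probability.Percolation.NewmanTassionWu2017_thm31` (NTW 2017, Theorem 3.1: for every `k ≥ 1` and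
`p = p_c(S_k)`, the box-crossing property `∀ ρ > 0 ∃ c_ρ > 0 ∀ n ≥ 1/ρ, c_ρ ≤ f(n, ⌊ρn⌋) ≤ 1 - c_ρ`):
`NewmanTassionWu2017_thm31_of_snapGadgets_box` (lead GEN 39/40: Theorem 3.1 from the gadget supply for the
coarse-grained gluing datum `NTW17.snapGlue` of Lemma 3.16, every other input of NTW §3 being in the tree)
composed with that supply, `NTW17.exists_gadget_snap` (`Literature/…/SlabRSWSnapGadget.lean`: `ρ = 1`,
`r = 14`, `n₀ = 40`, uniform in `k`).

* **`NewmanTassionWu2017_thm31_holds : NewmanTassionWu2017_thm31`**;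
* `boxCrossingProperty_slabCritical (k) (hk : 1 ≤ k) : BoxCrossingProperty k (p_c(S_k))` — the same per `k`.

References: C. M. Newman, V. Tassion, W. Wu, *Critical percolation and the minimal spanning tree in slabs*,
Comm. Pure Appl. Math. 70 (2017) = arXiv:1512.09107, Theorem 3.1 and §3 [NewmanTassionWu2017].
-/

noncomputable section

namespace Summit.CriticalPhenomena.PercolationContinuityZ3.Theorems.Crossing

open MeasureTheory
open Literature.Probability.Percolation Literature.Probability.LatticeModels
open Literature.Probability.Percolation.NTW17

/-- **Newman–Tassion–Wu 2017, Theorem 3.1** (the named fact `NewmanTassionWu2017_thm31`, discharged): for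
every `k ≥ 1`, bond percolation on the slab `S_k = ℤ² × {0,…,k}` at `p = p_c(S_k)` has the box-crossing
property. [cite: NewmanTassionWu2017, Theorem 3.1] -/
theorem NewmanTassionWu2017_thm31_holds : NewmanTassionWu2017_thm31 :=
  NewmanTassionWu2017_thm31_of_snapGadgets_box (ρ := 1) (r := 14) (n₀ := 40)
    fun _ hk _ hn hn₀ _ hΓ _ hω hX => exists_gadget_snap hn hk hn₀ hΓ hω hX

/-- **The box-crossing property at `p_c(S_k)`**, per thickness `k ≥ 1`.
[cite: NewmanTassionWu2017, Theorem 3.1] -/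
theorem boxCrossingProperty_slabCritical (k : ℕ) (hk : 1 ≤ k) :
    BoxCrossingProperty k (criticalProbIOf (slabGraph 3 k) (slabOrigin 3 k)) :=
  NewmanTassionWu2017_thm31_holds k hk

end Summit.CriticalPhenomena.PercolationContinuityZ3.Theorems.Crossing

end
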